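import Mathlib
import HarnessLib
import Literature.Computability.AlgebraicComplexity.PatternExpressions
import Summits.ValiantsHypothesis.ValiantsHypothesis.Theorems.MonotoneRestorationOrbitCompressionQPNarrowABP

/-!
# Route MonotoneRestoration — aside `OrbitCompressionQP` (stmt-ValiantsHypothesis-18332), line
# `expression_compression`: the symmetric-ABP criterion with polylogarithmically many labels

`NarrowClosure.narrowQP_of_matrixProduct` (file `…NarrowABP.lean`) is stated for `(1,1)`-label entries.  Hands on
the next rungs of `stub_narrowExpressionCompression` (orbit sums over several rows, the one-row stratum with
auxiliary labels) need entries with `k` row and `l` column labels, `n^{k+l} ≤ 2^{(log₂ n + c)^c}`; the balancing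
`NarrowClosure.exists_matrixProd` is already label-generic, so only the normalisation `close = n^{k+l} · value`
and the bookkeeping change:

* `close_eq_of_value_const_kl` — a `(k,l)`-expression with constant value `v` has `close = n^k n^l • v`;
* `narrowQP_of_matrixProduct_kl` — the criterion: `f n` = an entry of a product of `≤ Q` matrices of dimension
  `≤ Q` with `(k,l)`-label entries of length `≤ Q`, `n^{k+l} ≤ Q = 2^{(log₂ n + c)^c}` ⇒ `f` is narrow of
  quasi-polynomial length.

Helper file (`--supports stmt-ValiantsHypothesis-18332`); def-free; nothing here is a named fact; VP ≠ VNP is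
not moved.
-/

noncomputable section

open MvPolynomial

-- `Summit.ValiantsHypothesis.ValiantsHypothesis.…` is the tree's single-conjunct layout (Sub = Summit).
set_option linter.dupNamespace false

namespace Summit.ValiantsHypothesis.ValiantsHypothesis.Theorems

namespace NarrowClosure

open Literature.Computability.AlgebraicComplexity

/-- The closed polynomial of a `(k,l)`-expression whose value is constant is `n^k n^l` times that value.
[folklore] -/
theorem close_eq_of_value_const_kl {n k l : ℕ} (e : PatternExpr ℂ k l) (v : MvPolynomial (Fin n × Fin n) ℂ)
    (hv : ∀ (ρ : Fin k → Fin n) (γ : Fin l → Fin n), e.value n ρ γ = v) :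
    e.close n = ((n ^ k * n ^ l : ℕ) : ℂ) • v := by
  rw [PatternExpr.close]
  simp_rw [hv]
  simp only [Finset.sum_const, Finset.card_univ, Fintype.card_fun, Fintype.card_fin, smul_smul]
  rw [← Nat.cast_smul_eq_nsmul ℂ]

/-- **The symmetric-ABP criterion with `k + l` labels.**  If, for one constant `c` and every `n ≥ 1`, there are
label counts `k, l` with `n^{k+l} ≤ 2^{(log₂ n + c)^c}` such that `f n` is — at every label assignment — the
`(i, j)` entry of the product of `≤ 2^{(log₂ n + c)^c}` matrices of dimension `≤ 2^{(log₂ n + c)^c}` whose entries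
are `(k,l)`-label pattern expressions of length `≤ 2^{(log₂ n + c)^c}`, then `f` is narrow of quasi-polynomial
length. [folklore] -/
theorem narrowQP_of_matrixProduct_kl (f : (n : ℕ) → MvPolynomial (Fin n × Fin n) ℂ)
    (h : ∃ c : ℕ, ∀ n : ℕ, 1 ≤ n → ∃ (k l D : ℕ) (Lm : List (Matrix (Fin D) (Fin D) (PatternExpr ℂ k l)))
      (i j : Fin D),
      n ^ (k + l) ≤ 2 ^ ((Nat.log 2 n + c) ^ c) ∧ D ≤ 2 ^ ((Nat.log 2 n + c) ^ c) ∧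
      Lm.length ≤ 2 ^ ((Nat.log 2 n + c) ^ c) ∧
      (∀ M ∈ Lm, ∀ a b, (M a b).length ≤ 2 ^ ((Nat.log 2 n + c) ^ c)) ∧
      (∀ (ρ : Fin k → Fin n) (γ : Fin l → Fin n),
        ((Lm.map fun M : Matrix (Fin D) (Fin D) (PatternExpr ℂ k l) =>
          M.map fun e => e.value n ρ γ).prod) i j = f n)) :
    ∃ c : ℕ, ∀ n : ℕ, 1 ≤ n → ∃ (k l : ℕ) (e : PatternExpr ℂ k l),
      n ^ (k + l) ≤ 2 ^ ((Nat.log 2 n + c) ^ c) ∧ e.length ≤ 2 ^ ((Nat.log 2 n + c) ^ c) ∧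
      e.close n = f n := by
  obtain ⟨a, ha⟩ := h
  obtain ⟨c₂, hc₂⟩ := matrixProduct_length_qp a
  refine ⟨max a c₂, fun n hn => ?_⟩
  obtain ⟨k, l, D, Lm, i, j, hkl, hD, hN, hlen, hval⟩ := ha n hn
  have hLlen : Lm.length ≤ 2 ^ (Nat.log 2 Lm.length + 1) := (Nat.lt_pow_succ_log_self Nat.one_lt_two _).le
  obtain ⟨P, hPlen, hPval⟩ := exists_matrixProd (2 ^ ((Nat.log 2 n + a) ^ a)) (Nat.log 2 Lm.length + 1)
    Lm hLlen hlen
  have hv : ∀ (ρ : Fin k → Fin n) (γ : Fin l → Fin n), (P i j).value n ρ γ = f n := by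
    intro ρ γ
    have h := congrFun (congrFun (hPval n ρ γ) i) j
    rw [Matrix.map_apply] at h
    rw [h, hval ρ γ]
  have hn0 : ((n ^ k * n ^ l : ℕ) : ℂ) ≠ 0 := by
    have : 0 < n := hn
    exact Nat.cast_ne_zero.2 (by positivity)
  refine ⟨k, l, PatternExpr.mul (PatternExpr.const (((n ^ k * n ^ l : ℕ) : ℂ))⁻¹) (P i j), ?_, ?_, ?_⟩
  · exact hkl.trans (Nat.pow_le_pow_right (by norm_num) (CompressionFloors.polylog_mono (le_max_left _ _)))
  · have hl : (PatternExpr.mul (PatternExpr.const (((n ^ k * n ^ l : ℕ) : ℂ))⁻¹) (P i j)).length =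
        (P i j).length + 2 := by
      simp [PatternExpr.length]; ring
    rw [hl]
    calc (P i j).length + 2
        ≤ (2 * D + 2) ^ (Nat.log 2 Lm.length + 1) * (2 ^ ((Nat.log 2 n + a) ^ a) + D + 1) + 2 :=
          Nat.add_le_add_right (hPlen i j) 2
      _ ≤ 2 ^ ((Nat.log 2 n + c₂) ^ c₂) := hc₂ _ _ _ _ hD hN le_rfl
      _ ≤ _ := Nat.pow_le_pow_right (by norm_num) (CompressionFloors.polylog_mono (le_max_right _ _))
  · rw [ShortClose.close_const_mul, close_eq_of_value_const_kl _ _ hv, smul_smul, inv_mul_cancel₀ hn0,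
      one_smul]

end NarrowClosure

end Summit.ValiantsHypothesis.ValiantsHypothesis.Theorems

end
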